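import Summits.QuantumFields.YangMills.Theorems.UnitScaleTiltHalvingP1FlatCoreSupplierTopCallTraceFree
import Summits.QuantumFields.YangMills.Theorems.UnitScaleTiltHalvingP1FlatCoreSupplierInduction
import Summits.QuantumFields.YangMills.Theorems.UnitScaleTiltHalvingP1FlatCoreTopTargetRep
import Literature.MathematicalPhysics.QuantumFieldTheory.Balaban1983to89.B8SockHFPCubeMember
import Literature.MathematicalPhysics.QuantumFieldTheory.Balaban1983to89.B8Prop6OfThm4
import HarnessLib

/-!
# `hP1room` PROGRAMME (LEAD-H «H = hSupUρ2», (K-site) «top half»): ★★★ THE TOP-STEP ROWS OF ONE SITE FROM THE SOCKETS — ✓p648920 `topRows_of_datum_traceFree`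
# AT N05's CUBE MEMBER OF RECORD: MEMBER GEOMETRY, FLAT (1.33) AND THE REPRESENTATIVE LAW DISCHARGED BY NAME, J3's CURRENCY FOR `U′`, THE [4] LETTERS AS ONE PACKAGE

Route `UnitScaleTilt`, crux K1 child «MinimiserStabilityRegPr» (stmt-QuantumFields-19200), registered stub `stub_halvingStep` (`BirthV10`), display «H = hSupUρ2»
(LEAD-H L-11 v2 ∕ ★★OWNER №9a; outer knit (K-0) `hSupUρ2_of_siteRows` over ✓p647313 `hSupBlock_of_topRows`' 22 per-site rows).  Cell `ym3-torus` (HUMAN RULING D-0037: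
YM₃ on T³ is ladder rung R3 — NOT d = 4, NOT a mass gap, NOT the Clay problem), width seat `ym-ust-20520-w3` gen 6.  `--supports stmt-QuantumFields-19200 --as helper`;
THEOREMS ONLY (0 `def`, 0 `sorry`); count-neutral; nothing here claims `core′`, `hP1room(ρ2)`, `hSupU(ρ2)`, the stub, the crux or the gap.

WHAT.  ★★★ `siteTopRows_of_sockets` — at ONE site `x₀` (any torus `P`, any C⋆-algebra `𝔸`) with N05's cube member OF RECORD `Ω_j := cubeFam false L a M′ ρ′ (m+1) j`,
tower families `Λs := cubeLamS …`, `Λb := cubeLamB …` (lit `B8CubeMemberZd`; passed as defining equations, callers write `rfl`), level `k = m + 1 ≥ 2`: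
✓p648920 `HalvingP1FlatCoreSupplierTopCallTraceFree.topRows_of_datum_traceFree` with
* the member geometry `hΩ hbox hclass htower hlt htop` DISCHARGED (lit ✓`hΩ_cubeFam`, ✓`hbox_cubeLamB`, ✓`hclass_cubeLamB`, ✓`htw_cubeLamS`, ✓`h8lt_cubeLamS`, ✓`h8top_cubeLamS`);
* the flat (1.33) DISCHARGED (lit ✓`one_inAk`); (1.34), the axial class and (1.35) of the pre-gauged `U′` READ IN J3's CURRENCY (`hInAk`, `hAxJ`, `htw` — ✓p647600 §1
  `h34_of_inAk_univ` ∕ `hAx_of_inAx_one` ∕ `h135_cubeMember`, the SAME rows the datum half ([R-i]) reads);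
* the representative law `hrep` DISCHARGED (✓p642293 `hrep_cubeLamS`) for `rep := lift x₀ + rel x₀`, `y₀ := Bᵏx₀`;
* the [4] letters + laws + their τ-compatibility as ONE ∃-PACKAGE `SLetτ` (= lit `SockLettersRD`'s body at `(α₀, U₀ := 1, n := m+1)` ∧ lit `LettersTau`'s three fields —
  junction «(K-sock-τ)» for node N05∕N06's desk), destructured inside.
KEPT GENERIC (one line each in the composer's proof at `𝔸 = M₂(ℂ)`, `τ := trCLM (Fin 2)`): the group data — `G := SU(2)`-units, `H := SL(2, ℂ)`-units, (H2)
✓`trCLM_mlog_eq_zero_of_mem_slUnits`, (H3) ✓`expUnit_mem_slUnits`, ✓`avgClosed_specialUnitary`, ✓`specialUnitaryUnits_le_slUnits`, ✓`specialUnitaryUnits_le_unitaryUnits`,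
tracial ✓`trCLM_mul_comm` (lit ✓`B8SpecialLinearTrace`∕✓`B8SectERemainderTraceFreeSU`'s instantiation; `letI : CStarAlgebra (Matrix (Fin 2) (Fin 2) ℂ) := {}` — the b9 socket
`SockB9P3` has no matrix-level statement without that instance, junction «(K-inst)»).
DISPLAYED (uniform per member; №9 (3) inhabitability in brackets): constants∕formulas `hcs hα₄` [(N05-WINDOWS)]; `U′` unitary + J3's three rows [✓p645784 at `U′ := pull (U^{gJ})♯ 0`];
Theorem 4's datum rows `hu₁ hW h129 hLan hdat` [✓p647600 [R-i], N05 sockets inside] + τ-siblings `hu₁H`, `hAτ` [Sock-level τ-twin, N05]; the b9 socket `SB9` [OPEN = N06 [4]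
Thm 3.3 in-edge] + thresholds; Prop. 3's four windows; `SLetτ` [lit `SockLettersRD` = [4] Thm 3.1∕(3.25) letters, N06; τ-fields = `LettersTau`]; the JOIN∕family windows
[(N05-WINDOWS)]; the charted iterate `W₁` and F3's tower `κf` (letters); the torus target block `th hτ hth hthk hthlo haxT hthτ` [(K-DE): ✓p647825∕✓p648208]; the top
windows `ha₁' … h106`; the three top rows + `hTopTrace` [(K-DE): ✓p638927∕✓p643367∕✓p645555 at F3's `κf`].
CONCLUSION = ✓p648920's eight conjuncts AT THE MEMBER with `rep`, `y₀` instantiated: rows `hsa htr hsupp h108 hmult (lo) htopId hA0` — the «top half» of `hSiteRows`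
(the sizes `hX1 hX2` follow by ✓p647823 ∘ ✓p650567 from `h108`∕(lo)).  HONEST SCOPE: by-name instantiation; nothing of Prop. 5, Theorem 4, [4], `core′` or the stub is proved here.

References: T. Bałaban, CMP **99** (1985) 75–102 [Balaban1985RegularSpaces] (Prop. 5 (1.106)–(1.109) p.94, Thm 4 p.88, (1.4)–(1.6) p.77, (1.31) p.82, p.76, (1.131)–(1.133) p.99);
CMP **99** (1985) 389–434 [Balaban1985BackgroundPropagators] (Thm 3.1 p.397, (3.25) p.394, Thm 3.3 p.399); CMP **98** (1985) 17–51 [Balaban1985Averaging] (p.20, (208)–(214) p.50).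
-/

set_option autoImplicit false

noncomputable section

open scoped BigOperators
open NormedSpace
open Complex (I)

namespace Summit.QuantumFields.YangMills.Theorems.HalvingHSiteTopRowsOfSockets

open Literature.MathematicalPhysics.QuantumFieldTheory.Balaban1983to89
open T4Continuum
open MatrixLog (mlog)
open B5Eq118OneStroke (iterBlockOf)
open B7Prop1Explicit (Site e expUnit)
open B7Prop2Explicit (unitaryUnits C0 c2' avgIter AvgClosed)
open B7Prop3Flat (c3)
open B7Prop10General (C6 C4G)
open B7Prop9Flat (C5')
open B7Prop1Local (InBox loK bondHiK)
open B7Eq78Linearization (conjR zdBlocking QprimeIter)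
open B7Eq92Concrete (mgauge)
open B8Ineq130 (tlo thi)
open B8Ineq132 (covDerivFwd InAk)
open B8Eq119TwistedAxial (Restr129 InAx bgT)
open B8Eq131Cubes (gs tLo tHi)
open B8Eq131CubesAdmissible (cubeFam)
open B8CubeMemberZd (cubeLamS cubeLamB hΩ_cubeFam hbox_cubeLamB hclass_cubeLamB)
open B8SockHFPCubeMember (htw_cubeLamS h8lt_cubeLamS h8top_cubeLamS)
open B8Eq184Proof (gaugeExp cfgExp)
open B8Eq182Proof (gAd)
open B8Eq188Proof (frakF3)
open B8Eq140Level (SideTouches)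
open B8Eq138LandauZd (IsLandau138W covDivB covLap QT)
open B8Ineq125Concrete (C2p)
open B8Eq1117Concrete (XSpace)
open B8LeafModelZd3 (SockB9P3)
open B8Prop5ContractionKLevel (Bd2 Mc Kc)
open B8LambdaSpaceKLevel (wt)
open B8Eq178Averages (Qnl)
open B8Prop6OfThm4 (one_inAk)
open B10Eq27TorusAxialLog (rel axialT)
open B15Eq112TorusCover (lift cover)
open Node00 (coverAt)
open LatticeFieldCalculus (siteAvgIter)
open Summit.QuantumFields.YangMills.Theorems.Prop8ChartDoubleBar (dbarIterU)
open HalvingP1FlatCoreSupplierTopCallTraceFree (topRows_of_datum_traceFree)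
open HalvingP1FlatCoreSupplierInduction (h34_of_inAk_univ hAx_of_inAx_one h135_cubeMember)
open P1FlatCoreTopTargetRep (hrep_cubeLamS)

variable {P : Params} {𝔸 : Type*} [CStarAlgebra 𝔸] [Nontrivial 𝔸]

/-- ★★★ **THE TOP-STEP ROWS OF ONE SITE FROM THE SOCKETS** — see the module docstring: ✓p648920 `topRows_of_datum_traceFree` at N05's cube member of record with the member
geometry, the flat (1.33) and `hrep` discharged, J3's rows for `U′`, the [4] letters as one package; conclusion = its eight conjuncts at the member.
[cite: Balaban1985RegularSpaces, Prop. 5 (1.106)-(1.109) p.94, Thm 4 p.88, (1.4)-(1.6) p.77, (1.31) p.82, p.76, (1.131)-(1.133) p.99; Balaban1985BackgroundPropagators, Thm 3.1 p.397, (3.25) p.394, Thm 3.3 p.399; Balaban1985Averaging, p.20, (208)-(214) p.50] -/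
theorem siteTopRows_of_sockets (τ : 𝔸 →L[ℂ] ℂ) (hτtr : ∀ x y : 𝔸, τ (x * y) = τ (y * x)) (hd2 : 2 ≤ P.d) (hL : 2 ≤ P.L) {η : ℝ} (hη : 0 < η)
    -- the groups of the joint J-SU: `G` (averaging-closed, unitary; the flat background is `G`-valued) `≤ H` (values of `u₁`; (H2), (H3)) — at `M₂(ℂ)`: `SU(2) ≤ SL(2, ℂ)` by lit ✓`B8SpecialLinearTrace`
    {G H : Subgroup 𝔸ˣ} (hGrp2 : ∀ g ∈ H, ‖(g : 𝔸) - 1‖ ≤ 1 / 8 → τ (mlog (g : 𝔸)) = 0) (hGrp3 : ∀ S : 𝔸, τ S = 0 → expUnit S ∈ H)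
    (hGA : AvgClosed P.d P.L G) (hGH : G ≤ H) (hGu : G ≤ unitaryUnits 𝔸)
    -- the site, N05's cube member OF RECORD `Ω_j := □_j = cubeFam false L a M′ ρ′ (m+1) j` with its tower families (lit `B8CubeMemberZd`; defining equations, callers write `rfl`), level `k = m + 1 ≥ 2`
    (x₀ : Literature.MathematicalPhysics.QuantumFieldTheory.Balaban1983to89.Site P 0) {a : Site P.d} {M' ρ' : ℕ} (hρ' : P.L ≤ ρ')
    {m : ℕ} (hm1 : 1 ≤ m) (hmP : m + 1 ≤ P.m + P.K)
    (ha : ∀ ν, a ν ≤ ((iterBlockOf (m + 1) x₀ ν).val : ℤ) ∧ ((iterBlockOf (m + 1) x₀ ν).val : ℤ) ≤ a ν + M' - 1)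
    (hroomW : 2 * (P.L ^ (m + 1) * (M' + 1) + ρ' * gs P.L (m + 1)) ≤ P.sitesPerDir 0)
    {Ω : ℕ → Set (Site P.d)} (hΩdef : Ω = cubeFam false P.L a M' ρ' (m + 1))
    {Λs : ℕ → ℕ → Set (Site P.d)} (hΛsdef : Λs = cubeLamS P.L a M' ρ' (m + 1))
    {Λb : ℕ → ℕ → Set (Site P.d × Fin P.d)} (hΛbdef : Λb = cubeLamB P.L a M' ρ' (m + 1))
    -- the socket's antecedents: constants, (1.33), (1.34), (1.35)/(1.66) for the pre-gauged field `U′` at the flat background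
    {α₀ α₁ B₀ B₀' cs α₄ : ℝ} (hα₀ : 0 < α₀) (hα₁ : 0 < α₁) (hB₀ : 0 < B₀) (hB₀' : 0 < B₀')
    (hcs : cs = 5 * (P.d : ℝ) * P.L * B₀ * (α₀ + α₁)) (hα₄ : α₄ = 8 * B₀' * (5 * (P.d : ℝ) * P.L * B₀) * (α₀ + α₁))
    {U' : Site P.d → Fin P.d → 𝔸ˣ} (hU' : ∀ x κ, U' x κ ∈ unitaryUnits 𝔸)
    -- J3's pre-gauge rows for `U′` (currency of ✓`HalvingP1FlatCoreSupplierInduction` §1: (1.34)-𝔄 on `ℤᵈ`, axial at the flat background for every family, fine near-1 at every depth on the tilde-cube)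
    (hInAk : InAk P.L (m + 1) η α₀ (fun _ => (Set.univ : Set (Site P.d))) U')
    (hAxJ : ∀ m', m' ≤ m + 1 → ∀ Λ : ℕ → Set (Site P.d), InAx P.L m' Λ (1 : Site P.d → Fin P.d → 𝔸ˣ) U')
    (htw : ∀ m', m' ≤ m + 1 → ∀ (x : Site P.d) (ν : Fin P.d), tlo P.L (tLo a ρ') m' ≤ x → x + e ν ≤ thi P.L (tHi a M' ρ') m' →
      ‖((avgIter P.L U' (m + 1 - m') x ν : 𝔸ˣ) : 𝔸) - 1‖ < α₁)
    -- the datum at level `m`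
    {u₁ : Site P.d → 𝔸ˣ} {U₁ : Site P.d → Fin P.d → 𝔸ˣ} {A : Site P.d → Fin P.d → 𝔸}
    (hu₁ : ∀ x, u₁ x ∈ unitaryUnits 𝔸) (hu₁H : ∀ x, u₁ x ∈ H) (hW : mgauge (1 : Site P.d → Fin P.d → 𝔸ˣ) u₁ U₁ = U') (h129 : Restr129 P.L m (Λs m) (1 : Site P.d → Fin P.d → 𝔸ˣ) u₁)
    (hLan : IsLandau138W P.L m η (Ω 0) (Λs m) (1 : Site P.d → Fin P.d → 𝔸ˣ) U₁)
    (hdat : ∀ j, j ≤ m → ∀ b ∈ {b : Site P.d × Fin P.d | SideTouches (Ω j) b.1 b.2},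
      U₁ b.1 b.2 = cfgExp η A b.1 b.2 ∧ IsSelfAdjoint (A b.1 b.2) ∧ ‖A b.1 b.2‖ ≤ cs * ((P.L : ℝ) ^ j * η)⁻¹)
    (hAτ : ∀ j, j ≤ m → ∀ b ∈ {b : Site P.d × Fin P.d | SideTouches (Ω j) b.1 b.2}, τ (A b.1 b.2) = 0)
    -- the b9 socket in Proposition 3's frame AT LEVEL `m`, and its threshold
    {B₀β cB9 β : ℝ} {len : Site P.d → ℝ} (SB9 : SockB9P3 (𝔸 := 𝔸) P.L B₀ B₀β cB9 β len η m Ω Λs Λb)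
    (hα₀9 : α₀ ≤ cB9) (hcs9 : cs ≤ cB9)
    -- Proposition 3's windows at `(α₀, α₂ := c⋆)` not implied by the JOIN's
    {C₂ : ℝ} (hside : 36 * P.d * B₀ * cs ≤ 1 / 2)
    (hC₂ : 8 * (131072 * ((P.d : ℝ) + 1) ^ 2) * Real.exp (4 * (800 * ((P.d : ℝ) + 1) ^ 2 * ((P.d : ℝ) + 4)) * α₀) ≤ C₂)
    (h61 : 2 * cs ^ 2 + 20 * P.d * α₀ * cs + 2 * C₂ * cs ^ 2 ≤ α₀ + α₁) (hsmall₁ : (P.d : ℝ) * P.L * α₁ ≤ 1 / 8)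
    -- the [4] LETTERS at `(m + 1, U₀ := 1)` AS ONE PACKAGE: lit `SockLettersRD`'s body at `(α₀, U₀ := 1, n := m + 1)` ∧ the letters' `τ`-compatibility (lit `LettersTau`'s three fields) — junction «(K-sock-τ)»
    {B₀'H B₂' BG BR : ℝ} (hB₀'H : 0 < B₀'H) (hB₂' : 0 ≤ B₂') (hBG : 0 ≤ BG) (hBR : 0 ≤ BR)
    (SLetτ : ∃ (g Δ : (Site P.d → 𝔸) →ₗ[ℂ] (Site P.d → 𝔸)) (q : (Site P.d → 𝔸) →ₗ[ℂ] (ℕ → Site P.d → 𝔸))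
        (qs : (ℕ → Site P.d → 𝔸) →ₗ[ℂ] (Site P.d → 𝔸)) (Aw c : (ℕ → Site P.d → 𝔸) →ₗ[ℂ] (ℕ → Site P.d → 𝔸)) (H' : XSpace P.d (m + 1) 𝔸 →ₗ[ℂ] (Site P.d → 𝔸)),
      (∀ x, ∀ y ∈ Ω 0, (Δ (g x) + qs (Aw (q (g x)))) y = x y) ∧ (∀ f, q (g (g (qs (c (q f))))) = q f) ∧
      (∀ (f : Site P.d → 𝔸), ∀ x ∈ Ω 0, Δ f x = covLap η (1 : Site P.d → Fin P.d → 𝔸ˣ) ((Ω 0).indicator f) x) ∧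
      (∀ (μ : ℕ → Site P.d → 𝔸), ∀ x ∈ Ω 0, qs μ x = QT P.L (m + 1) (Λs (m + 1)) (1 : Site P.d → Fin P.d → 𝔸ˣ) μ x) ∧
      (∀ (f : Site P.d → 𝔸) (j : ℕ), j ≤ m + 1 → ∀ y ∈ Λs (m + 1) j, q f j y = QprimeIter (zdBlocking P.d P.L) (bgT P.L (1 : Site P.d → Fin P.d → 𝔸ˣ)) j f y) ∧
      (∀ (X : XSpace P.d (m + 1) 𝔸) (x : Site P.d), ‖H' X x‖ ≤ B₀'H * ‖X‖) ∧
      (∀ j, j ≤ m + 1 → ∀ (X : XSpace P.d (m + 1) 𝔸), ∀ p ∈ {b : Site P.d × Fin P.d | SideTouches (Ω j) b.1 b.2},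
        wt P.L η j * ‖covDerivFwd η (1 : Site P.d → Fin P.d → 𝔸ˣ) p.2 (H' X) p.1‖ ≤ B₀'H * ‖X‖) ∧
      (∀ X : XSpace P.d (m + 1) 𝔸, Bd2 P.L η (m + 1) Ω (covLap η (1 : Site P.d → Fin P.d → 𝔸ˣ) (H' X)) (B₂' * ‖X‖)) ∧
      (∀ (X : XSpace P.d (m + 1) 𝔸) (x : Site P.d), x ∉ Ω 0 → H' X x = 0) ∧
      (∀ X Y : XSpace P.d (m + 1) 𝔸, (∀ p, Y p = -star (X p)) → ∀ x, H' Y x = -star (H' X x)) ∧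
      (∀ (Y : XSpace P.d (m + 1) 𝔸) (j : ℕ) (hj : j ≤ m + 1) (y : Site P.d), y ∈ Λs (m + 1) j →
        QprimeIter (zdBlocking P.d P.L) (bgT P.L (1 : Site P.d → Fin P.d → 𝔸ˣ)) j (H' Y) y = Y (⟨j, Nat.lt_succ_of_le hj⟩, y)) ∧
      (∀ (f : Site P.d → 𝔸) (r : ℝ), 0 ≤ r → Bd2 P.L η (m + 1) Ω f r →
        (∀ x, ‖g f x‖ ≤ BG * r) ∧ ∀ j, j ≤ m + 1 → ∀ p ∈ {b : Site P.d × Fin P.d | SideTouches (Ω j) b.1 b.2},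
          wt P.L η j * ‖covDerivFwd η (1 : Site P.d → Fin P.d → 𝔸ˣ) p.2 (g f) p.1‖ ≤ BG * r) ∧
      (∀ (f : Site P.d → 𝔸) (x : Site P.d), x ∉ Ω 0 → g f x = 0) ∧
      (∀ f : Site P.d → 𝔸, (∀ j, j ≤ m + 1 → ∀ x ∈ Ω j, IsSelfAdjoint (f x)) → ∀ x, IsSelfAdjoint (g f x)) ∧
      (∀ (f : Site P.d → 𝔸) (r : ℝ), 0 ≤ r → Bd2 P.L η (m + 1) Ω f r → Bd2 P.L η (m + 1) Ω (f - g (qs (c (q (g f))))) (BR * r)) ∧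
      (∀ f : Site P.d → 𝔸, (∀ j, j ≤ m + 1 → ∀ x ∈ Ω j, IsSelfAdjoint (f x)) → ∀ j, j ≤ m + 1 → ∀ x ∈ Ω j, IsSelfAdjoint ((f - g (qs (c (q (g f))))) x)) ∧
      (∀ X : XSpace P.d (m + 1) 𝔸, (∀ p, τ (X p) = 0) → ∀ x, τ (H' X x) = 0) ∧
      (∀ f : Site P.d → 𝔸, (∀ j, j ≤ m + 1 → ∀ x ∈ Ω j, τ (f x) = 0) → ∀ x, τ (g f x) = 0) ∧
      (∀ f : Site P.d → 𝔸, (∀ j, j ≤ m + 1 → ∀ x ∈ Ω j, τ (f x) = 0) → ∀ j, j ≤ m + 1 → ∀ x ∈ Ω j, τ ((f - g (qs (c (q (g f))))) x) = 0))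
    -- the JOIN's scalar windows (the lower family's, N05's letters; `cB cA cDA` free above their datum values)
    {cB cA cDA : ℝ} (hcBlo : P.L * cs ≤ cB) (hcAlo : P.L * cs ≤ cA) (hcDAlo : (P.d : ℝ) * (P.L : ℝ) ^ 2 * cs ≤ cDA)
    (hα3 : C0 P.d * α₀ ≤ 1 / 3) (hα4 : 4 * α₀ ≤ c2' P.d P.L)
    (hsmall : Real.exp (4 * (800 * ((P.d : ℝ) + 1) ^ 2 * ((P.d : ℝ) + 4)) * α₀) * (1 + 8 * (131072 * ((P.d : ℝ) + 1) ^ 2) * cB) ≤ 2)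
    (hc₃ : 2 * cB ≤ c3 P.d P.L) (hsc : 2048 * (P.d : ℝ) * cB ≤ 1) (hα₃' : 40 * P.d * cB ≤ 1 / 200)
    (hs₁ : 200 * C6 P.d * (2 * α₄) ≤ 1) (hs₂ : 12000 * ((P.d : ℝ) + 1) * P.L * (2 * α₄) ≤ 1)
    (hs₃ : C4G P.d P.L * (α₀ + 40 * P.d * cB + 4 * (2 * α₄)) ≤ 1)
    (hs₄ : 1024 * ((P.d : ℝ) + 1) * ((P.d : ℝ) + 4) * P.L ^ 2 * α₀ ≤ 1) (hs₅ : 32 * ((P.d : ℝ) + 1) ^ 2 * C6 P.d * P.L ^ 2 * α₀ ≤ 1)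
    (hs₆ : 16 * P.d * C5' P.d * C6 P.d * (P.L : ℝ) ^ 2 * α₀ ≤ 1) (hs₇ : 8 * P.d * C6 P.d * P.L * α₀ ≤ 1)
    (hprod8 : 2 * C6 P.d * (40 * P.d * cB + 4 * α₄) ≤ 1 / 8) (hcA' : cA ≤ 1 / 13)
    -- the family constants of the top step: above the lower family's; the top member's are the torus windows' business
    {Cb Cl : ℝ} (hCblo : C2p P.d * (40 * P.d * cB + α₄) * α₄ ≤ Cb) (hCllo : 2 * C2p P.d * (40 * P.d * cB + 2 * α₄) ≤ Cl)
    (hCbρ : Cb ≤ α₄ / (2 * B₀'H)) (hClB : Cl * B₀'H ≤ 1 / 2)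
    -- (D) the torus side: the effective-gauge tower of the charted iterate, the representative, the target (✓p636261's letters VERBATIM at `k := m + 1`)
    (W₁ : GaugeField P 0 𝔸ˣ) (κf : (Literature.MathematicalPhysics.QuantumFieldTheory.Balaban1983to89.Site P 0 → 𝔸) → (i : ℕ) → GaugeTransf P i 𝔸ˣ)
    (th : XSpace P.d (m + 1) 𝔸) (hτ : B₀'H * ‖th‖ < α₄ / 4) (hth : ∀ p, star (th p) = -th p)
    (hthk : ∀ yc ∈ Λs (m + 1) (m + 1), th (⟨m + 1, Nat.lt_succ_self (m + 1)⟩, yc) = mlog ((axialT (dbarIterU (m + 1) W₁) (iterBlockOf (m + 1) x₀) (coverAt P (m + 1) yc) : 𝔸ˣ) : 𝔸))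
    (hthlo : ∀ (j : ℕ) (hj : j < m + 1) (y : Site P.d), y ∈ Λs (m + 1) j → th (⟨j, Nat.lt_succ_of_lt hj⟩, y) = 0)
    (haxT : ∀ yc ∈ Λs (m + 1) (m + 1), ‖((axialT (dbarIterU (m + 1) W₁) (iterBlockOf (m + 1) x₀) (coverAt P (m + 1) yc) : 𝔸ˣ) : 𝔸) - 1‖ < 1)
    -- the top-step windows at the Sect. E sizes (✓p636261's letters VERBATIM, `B₀' := B₀'H`)
    (ha₁' : α₄ / 4 + B₀'H * (Cb + ‖th‖) ≤ 1 / 24) (hb₁' : α₄ / 4 + B₀'H * (Cb + ‖th‖) ≤ 1 / 140)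
    (hθ : 10 * (α₄ / 4 + B₀'H * (Cb + ‖th‖)) * BR ≤ 1 / 2) (hh₀' : B₀'H * (Cb + ‖th‖) ≤ 3 * α₄ / 4)
    (h103 : BG * Mc P.d BR (α₄ / 4 + B₀'H * (Cb + ‖th‖)) cA (B₂' * (Cb + ‖th‖)) cDA ≤ α₄ / 4)
    (h106 : BG * Kc P.d BR (α₄ / 4 + B₀'H * (Cb + ‖th‖)) cA (B₂' * (Cb + ‖th‖)) cDA (B₂' * (2 * Cl)) (1 + B₀'H * (2 * Cl)) (1 + B₀'H * (2 * Cl))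
      ≤ 1 / 2)
    -- (E) the three top rows in torus letters on the tower box (✓p636261's letters VERBATIM at `k := m + 1`)
    (hTop121 : ∀ yc ∈ Λs (m + 1) (m + 1), ∀ l₀ : Literature.MathematicalPhysics.QuantumFieldTheory.Balaban1983to89.Site P 0 → 𝔸,
      (∀ x : Site P.d, InBox (tlo P.L yc (m + 1)) (thi P.L yc (m + 1)) x → ‖l₀ (cover P x)‖ ≤ α₄) →
      (∀ (x : Site P.d) (κ : Fin P.d), InBox (tlo P.L yc (m + 1)) (thi P.L yc (m + 1)) x → InBox (tlo P.L yc (m + 1)) (thi P.L yc (m + 1)) (x + e κ) →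
        ‖l₀ (cover P (x + e κ)) - l₀ (cover P x)‖ ≤ α₄ * ((P.L : ℝ) ^ (m + 1))⁻¹) →
      exp (mlog ((κf l₀ (m + 1) (coverAt P (m + 1) yc) : 𝔸ˣ) : 𝔸)) = ((κf l₀ (m + 1) (coverAt P (m + 1) yc) : 𝔸ˣ) : 𝔸) ∧
        ‖mlog ((κf l₀ (m + 1) (coverAt P (m + 1) yc) : 𝔸ˣ) : 𝔸) - siteAvgIter (m + 1) l₀ (coverAt P (m + 1) yc)‖ ≤ Cb)
    (hTop125 : ∀ yc ∈ Λs (m + 1) (m + 1), ∀ (l₁ l₂ : Literature.MathematicalPhysics.QuantumFieldTheory.Balaban1983to89.Site P 0 → 𝔸) (r : ℝ), 0 ≤ r →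
      (∀ x : Site P.d, InBox (tlo P.L yc (m + 1)) (thi P.L yc (m + 1)) x → ‖l₁ (cover P x)‖ ≤ α₄) →
      (∀ (x : Site P.d) (κ : Fin P.d), InBox (tlo P.L yc (m + 1)) (thi P.L yc (m + 1)) x → InBox (tlo P.L yc (m + 1)) (thi P.L yc (m + 1)) (x + e κ) →
        ‖l₁ (cover P (x + e κ)) - l₁ (cover P x)‖ ≤ α₄ * ((P.L : ℝ) ^ (m + 1))⁻¹) →
      (∀ x : Site P.d, InBox (tlo P.L yc (m + 1)) (thi P.L yc (m + 1)) x → ‖l₂ (cover P x)‖ ≤ α₄) →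
      (∀ (x : Site P.d) (κ : Fin P.d), InBox (tlo P.L yc (m + 1)) (thi P.L yc (m + 1)) x → InBox (tlo P.L yc (m + 1)) (thi P.L yc (m + 1)) (x + e κ) →
        ‖l₂ (cover P (x + e κ)) - l₂ (cover P x)‖ ≤ α₄ * ((P.L : ℝ) ^ (m + 1))⁻¹) →
      (∀ x : Site P.d, InBox (tlo P.L yc (m + 1)) (thi P.L yc (m + 1)) x → ‖l₁ (cover P x) - l₂ (cover P x)‖ ≤ r) →
      (∀ (x : Site P.d) (κ : Fin P.d), InBox (tlo P.L yc (m + 1)) (thi P.L yc (m + 1)) x → InBox (tlo P.L yc (m + 1)) (thi P.L yc (m + 1)) (x + e κ) →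
        ‖(l₁ (cover P (x + e κ)) - l₂ (cover P (x + e κ))) - (l₁ (cover P x) - l₂ (cover P x))‖ ≤ r * ((P.L : ℝ) ^ (m + 1))⁻¹) →
      ‖(mlog ((κf l₁ (m + 1) (coverAt P (m + 1) yc) : 𝔸ˣ) : 𝔸) - siteAvgIter (m + 1) l₁ (coverAt P (m + 1) yc)) -
          (mlog ((κf l₂ (m + 1) (coverAt P (m + 1) yc) : 𝔸ˣ) : 𝔸) - siteAvgIter (m + 1) l₂ (coverAt P (m + 1) yc))‖ ≤ Cl * r)
    (hTopReal : ∀ yc ∈ Λs (m + 1) (m + 1), ∀ l₀ : Literature.MathematicalPhysics.QuantumFieldTheory.Balaban1983to89.Site P 0 → 𝔸,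
      (∀ x : Site P.d, InBox (tlo P.L yc (m + 1)) (thi P.L yc (m + 1)) x → ‖l₀ (cover P x)‖ ≤ α₄) →
      (∀ (x : Site P.d) (κ : Fin P.d), InBox (tlo P.L yc (m + 1)) (thi P.L yc (m + 1)) x → InBox (tlo P.L yc (m + 1)) (thi P.L yc (m + 1)) (x + e κ) →
        ‖l₀ (cover P (x + e κ)) - l₀ (cover P x)‖ ≤ α₄ * ((P.L : ℝ) ^ (m + 1))⁻¹) →
      mlog ((κf (fun s => -star (l₀ s)) (m + 1) (coverAt P (m + 1) yc) : 𝔸ˣ) : 𝔸) - siteAvgIter (m + 1) (fun s => -star (l₀ s)) (coverAt P (m + 1) yc) =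
        -star (mlog ((κf l₀ (m + 1) (coverAt P (m + 1) yc) : 𝔸ˣ) : 𝔸) - siteAvgIter (m + 1) l₀ (coverAt P (m + 1) yc)))
    -- (τ) the torus τ-rows of (τ-3): the target and the top member (suppliers ✓`…TopTargetTrace`, ✓`…TopRowsTrace`)
    (hthτ : ∀ p, τ (th p) = 0)
    (hTopTrace : ∀ yc ∈ Λs (m + 1) (m + 1), ∀ l₀ : Literature.MathematicalPhysics.QuantumFieldTheory.Balaban1983to89.Site P 0 → 𝔸, (∀ s, τ (l₀ s) = 0) →
      (∀ x : Site P.d, InBox (tlo P.L yc (m + 1)) (thi P.L yc (m + 1)) x → ‖l₀ (cover P x)‖ ≤ α₄) →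
      (∀ (x : Site P.d) (κ : Fin P.d), InBox (tlo P.L yc (m + 1)) (thi P.L yc (m + 1)) x → InBox (tlo P.L yc (m + 1)) (thi P.L yc (m + 1)) (x + e κ) →
        ‖l₀ (cover P (x + e κ)) - l₀ (cover P x)‖ ≤ α₄ * ((P.L : ℝ) ^ (m + 1))⁻¹) →
      τ (mlog ((κf l₀ (m + 1) (coverAt P (m + 1) yc) : 𝔸ˣ) : 𝔸) - siteAvgIter (m + 1) l₀ (coverAt P (m + 1) yc)) = 0) :
    ∃ lam : Site P.d → 𝔸, (∀ x, IsSelfAdjoint (lam x)) ∧ (∀ x, x ∉ Ω 0 → lam x = 0) ∧ (∀ x, τ (lam x) = 0) ∧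
      (∀ j, j ≤ m + 1 → ∀ b ∈ {b : Site P.d × Fin P.d | SideTouches (Ω j) b.1 b.2},
        ‖lam b.1‖ ≤ α₄ ∧ wt P.L η j * ‖covDerivFwd η (1 : Site P.d → Fin P.d → 𝔸ˣ) b.2 lam b.1‖ ≤ α₄) ∧
      (∃ μ : ℕ → Site P.d → 𝔸, ∀ x ∈ Ω 0,
        covLap η (1 : Site P.d → Fin P.d → 𝔸ˣ) ((Ω 0).indicator fun y =>
          covDivB η (1 : Site P.d → Fin P.d → 𝔸ˣ) A y + covLap η (1 : Site P.d → Fin P.d → 𝔸ˣ) lam y +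
          ((conjR (gaugeExp lam y)⁻¹ (covDivB η (1 : Site P.d → Fin P.d → 𝔸ˣ) A y) - covDivB η (1 : Site P.d → Fin P.d → 𝔸ˣ) A y) +
            (gAd (covLap η (1 : Site P.d → Fin P.d → 𝔸ˣ) lam y) (lam y) - covLap η (1 : Site P.d → Fin P.d → 𝔸ˣ) lam y) +
            ∑ μ, frakF3 η (1 : Site P.d → Fin P.d → 𝔸ˣ) lam A y μ)) x = QT P.L (m + 1) (Λs (m + 1)) (1 : Site P.d → Fin P.d → 𝔸ˣ) μ x) ∧
      (∀ j, j < m + 1 → ∀ y ∈ Λs (m + 1) j,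
        Qnl P.L (1 : Site P.d → Fin P.d → 𝔸ˣ) (fun x => expUnit (((-I) • lam) x)) u₁⁻¹ j y = 0) ∧
      (∀ yc ∈ Λs (m + 1) (m + 1), κf (((-I) • lam) ∘ fun s : Literature.MathematicalPhysics.QuantumFieldTheory.Balaban1983to89.Site P 0 => lift P x₀ + rel x₀ s) (m + 1) (coverAt P (m + 1) yc) = axialT (dbarIterU (m + 1) W₁) (iterBlockOf (m + 1) x₀) (coverAt P (m + 1) yc)) ∧
      (∀ x ∈ Ω 0, ∀ μ : Fin P.d,
        wt P.L η 0 * ‖A x μ‖ ≤ cA ∧ wt P.L η 0 * ‖conjR ((1 : Site P.d → Fin P.d → 𝔸ˣ) (x - e μ) μ)⁻¹ (A (x - e μ) μ)‖ ≤ cA) := by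
  subst hΩdef hΛsdef hΛbdef
  have hL1 : 1 ≤ P.L := le_trans (by norm_num) hL
  have hρ'1 : 1 ≤ ρ' := hL1.trans hρ'
  -- the member geometry (lit `B8CubeMemberZd` ∕ `B8SockHFPCubeMember`, BY NAME)
  have hΩ := hΩ_cubeFam (d := P.d) hL1 a M' hρ' (m + 1)
  have hbox := hbox_cubeLamB (d := P.d) P.L a M' ρ' (m + 1)
  have hclass := hclass_cubeLamB (d := P.d) P.L a M' ρ' (m + 1)
  have htower := htw_cubeLamS (d := P.d) hL1 a M' ρ' (m + 1) (m + 1) le_rfl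
  have hlt := h8lt_cubeLamS (d := P.d) P.L a M' ρ' (m + 1) m (lt_add_one m)
  have htop := h8top_cubeLamS (d := P.d) hL1 a M' ρ' (m + 1) m (lt_add_one m)
  -- the pre-gauged field's rows at the flat background: (1.33) of `1`, (1.34)∕(Ax)∕(1.35) from J3's currency (✓p647600 §1)
  have h33 : InAk P.L (m + 1) η α₀ (cubeFam false P.L a M' ρ' (m + 1)) (1 : Site P.d → Fin P.d → 𝔸ˣ) := one_inAk hL1 (m + 1) hη hα₀ _
  have h34 := h34_of_inAk_univ hInAk (cubeFam false P.L a M' ρ' (m + 1))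
  have hAx := hAx_of_inAx_one hAxJ (cubeLamS P.L a M' ρ' (m + 1))
  have h135 := h135_cubeMember (𝔸 := 𝔸) hL a M' hρ'1 htw
  -- the representative law on the top tower boxes (✓p642293)
  have hrep := hrep_cubeLamS (P := P) hmP x₀ ha hroomW
  -- the letters
  obtain ⟨g, Δ, q, qs, Aw, c, H', g_rightΩ, c_range, hΔ, hqs, hq, hH0, hH1, hH2, hHsupp, hHequiv, hQH, hG, hGsupp, hGreal, hRbd, hRreal, hHτ, hGτ, hRτ⟩ := SLetτ
  -- THE CALL (✓p648920, BY NAME)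
  exact topRows_of_datum_traceFree (P := P) τ hτtr hd2 hL hη (K₀ := m + 1) hGrp2 hGrp3 hGA hGH hGu
    hΩ hbox hclass hm1 (lt_add_one m) hmP htower hlt htop hα₀ hα₁ hB₀ hB₀' hcs hα₄ hU' h33 h34 hAx h135 hu₁ hu₁H hW h129 hLan hdat hAτ SB9 hα₀9 hcs9
    hside hC₂ h61 hsmall₁ g Δ q qs Aw c g_rightΩ c_range hΔ hqs hq H' hB₀'H hB₂' hBG hBR hH0 hH1 hH2 hHsupp hHequiv hQH hG hGsupp hGreal hRbd hRreal hHτ hGτ hRτ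
    hcBlo hcAlo hcDAlo hα3 hα4 hsmall hc₃ hsc hα₃' hs₁ hs₂ hs₃ hs₄ hs₅ hs₆ hs₇ hprod8 hcA' hCblo hCllo hCbρ hClB W₁ κf
    (fun s => lift P x₀ + rel x₀ s) hrep (iterBlockOf (m + 1) x₀) th hτ hth hthk hthlo haxT ha₁' hb₁' hθ hh₀' h103 h106 hTop121 hTop125 hTopReal hthτ hTopTrace

end Summit.QuantumFields.YangMills.Theorems.HalvingHSiteTopRowsOfSockets

end
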